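import Summits.Parity.BatemanHorn.Theorems.SelbergDelangeRigidityDefs
import Literature.NumberTheory.LFunctions.LevinFainleibDirichlet
import Literature.NumberTheory.LFunctions.TauberianTheoremsProofs
import HarnessLib

/-!
# Route `SelbergDelangeRigidity`, crux `LSDRealSegment` (stmt-Parity-9770), line
# `product-anatomy-subcritical`: the Levin–Faĭnleĭb mean-value theorem in asymptotic form
# (helper of `stub_typeI`; stated for a GENERAL non-negative multiplicative `g`)

**Levin–Faĭnleĭb 1967 / Halberstam–Richert 1974 Lemma 5.4 / Wirsing, asymptotic form with the constant
identified.**  Let `g ≥ 0` be multiplicative with `g(1) = 1`, `κ ≥ 0`, and assume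
(H1) `|Σ_{p ≤ Q} g(p) log p − κ log Q| ≤ L` (`Q ≥ 2`) and
(H2) `Σ_{p ≤ N} g(p)² log p + Σ_{p ≤ N} Σ_{2 ≤ ν ≤ N} g(p^ν) log p^ν ≤ A` (bounded partial sums).
Then the ORDERED product `P = ∏_p (Σ_ν g(p^ν)) (1 − 1/p)^κ` converges, `P > 0`, and
`Σ_{d ≤ D} g(d) ~ (P / Γ(κ+1)) (log D)^κ` (`typeI_levinFainleib`, the registered helper).

Proof: the tree's Literature files `LevinFainleibPrimeSums` / `LocalFactors` / `Product` / `Dirichlet`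
(everything PROVED there) give the continuous limit `Φ = lim_N Σ_{p ≤ N} (log F_p(s) + κ log(1 − p^{-1-s}))` on
`s ≥ 0`, the convergence of the ordered product to `exp Φ(0)`, the convergence of `Σ g(n) n^{-s}` for `s > 0`
and the Abelian asymptotics `(σ − 1)^κ Σ (n g(n)) n^{-σ} → exp Φ(0)` (`σ → 1⁺`); the PROVED
Hardy–Littlewood–Karamata Tauberian theorem for Dirichlet series
(`Literature.NumberTheory.LFunctions.HardyLittlewoodTauberianDirichlet_holds`, Montgomery–Vaughan Thm 5.11, with
`a_n = n g(n) ≥ 0`, `β = κ`, `A = 0`) converts this into `Σ_{n ≤ N} g(n) / (log N)^κ → exp Φ(0) / Γ(κ+1)`.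
This is the shape of the sibling line's predicate `LevinFainleibAsymp g κ`
(`Theorems/AlmostPrimeZerosDefs.lean`, crux stmt-Parity-11292), with `0 < P` added.
-/

open Filter Finset Polynomial
open scoped BigOperators Topology Classical

namespace Summit.Parity.BatemanHorn.Cruxes.LSDRealSegment.ProductAnatomySubcritical

open Literature.NumberTheory.Sieve
open Literature.NumberTheory.LFunctions
open ArithmeticFunction (cardFactors)
noncomputable section

/-- **typeI_levinFainleib** (registered helper of `stub_typeI`, line `product-anatomy-subcritical`):
the logarithmic mean-value theorem of Levin–Faĭnleĭb / Halberstam–Richert Lemma 5.4 in asymptotic form.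
For `g ≥ 0` multiplicative with `g 1 = 1`, `κ ≥ 0`, (H1) `|Σ_{p ≤ Q} g(p) log p − κ log Q| ≤ L` and
(H2) `Σ_{p≤N} g(p)² log p + Σ_{p≤N} Σ_{2≤ν≤N} g(p^ν) log p^ν ≤ A`: the ordered product
`∏_{p ≤ N} (Σ_ν g(p^ν))(1 − 1/p)^κ` converges to some `P > 0` and `Σ_{d ≤ D} g(d) / (log D)^κ → P / Γ(κ+1)`
(Karamata / Hardy–Littlewood Tauberian route through `Σ g(d) d^{-s} ∼ P s^{-κ}`, `s → 0⁺`).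
[cite: HalberstamRichert1974, Lemma 5.4] -/
theorem typeI_levinFainleib : ∀ (g : ℕ → ℝ) (κ : ℝ), 0 ≤ κ → (∀ n, 0 ≤ g n) → g 1 = 1 →
    (∀ m n : ℕ, m.Coprime n → g (m * n) = g m * g n) →
    (∃ L : ℝ, ∀ Q : ℕ, 2 ≤ Q →
      |(∑ p ∈ Nat.primesLE Q, g p * Real.log p) - κ * Real.log Q| ≤ L) →
    (∃ A : ℝ, ∀ N : ℕ, (∑ p ∈ Nat.primesLE N, g p ^ 2 * Real.log p) +
      (∑ p ∈ Nat.primesLE N, ∑ ν ∈ Icc 2 N, g (p ^ ν) * Real.log ((p : ℝ) ^ ν)) ≤ A) →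
    ∃ P : ℝ, 0 < P ∧
      Tendsto (fun N : ℕ => ∏ p ∈ Nat.primesLE N, (∑' ν : ℕ, g (p ^ ν)) * (1 - 1 / (p : ℝ)) ^ κ)
        atTop (𝓝 P) ∧
      Tendsto (fun D : ℕ => (∑ d ∈ Icc 1 D, g d) / Real.log D ^ κ) atTop
        (𝓝 (P / Real.Gamma (κ + 1))) := by
  intro g κ hκ hg0 hg1 hmul h1 h2
  obtain ⟨A, hA⟩ := h2
  obtain ⟨Φ, hΦ, hcont⟩ := LevinFainleib.exists_tendsto_logProduct hg0 hg1 hκ h1 hA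
  refine ⟨Real.exp (Φ 0), Real.exp_pos _,
    LevinFainleib.tendsto_prod_primesLE_of_tendsto hg0 hg1 hA κ (hΦ 0 le_rfl), ?_⟩
  -- the Abelian hypothesis of the Tauberian theorem for `a_n = n g(n)`
  have hT := LevinFainleib.tendsto_rpow_mul_tsum_sigma hg0 hg1 hmul hκ hA hΦ hcont
  have hS : ∀ σ : ℝ, 1 < σ → Summable fun n : ℕ => (n : ℝ) * g n / (n : ℝ) ^ σ := by
    intro σ hσ
    have hs : 0 < σ - 1 := by linarith
    refine (LevinFainleib.summable_div_rpow hg0 hg1 hmul hκ hA hs (hΦ (σ - 1) hs.le)).congr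
      fun n => ?_
    rw [LevinFainleib.mul_div_rpow_eq_div_rpow_sub_one g hσ n]
  have hTaub : ∀ n : ℕ, 1 ≤ n → -(0 : ℝ) * (1 + Real.log n) ^ (κ - 1) ≤ (n : ℝ) * g n := by
    intro n _
    rw [neg_zero, zero_mul]
    exact mul_nonneg (Nat.cast_nonneg _) (hg0 n)
  have hHL := HardyLittlewoodTauberianDirichlet_holds (fun n => (n : ℝ) * g n) (Real.exp (Φ 0)) κ 0
    hκ hS hT hTaub
  refine hHL.congr' (Eventually.of_forall fun N => ?_)
  dsimp only
  congr 1
  refine Finset.sum_congr rfl fun n hn => ?_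
  have hn1 : (n : ℝ) ≠ 0 := by
    have : 1 ≤ n := (Finset.mem_Icc.mp hn).1
    exact_mod_cast (show n ≠ 0 by omega)
  field_simp

end

end Summit.Parity.BatemanHorn.Cruxes.LSDRealSegment.ProductAnatomySubcritical
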